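import Mathlib
import HarnessLib
import Literature.Probability.Percolation.QuadCrossingSquareModel
import Literature.Barriers.CriticalPhenomena.EmbeddingModulusUniquenessProofs
import Literature.Probability.RandomPlanarGeometry.ConformalRectangleProofs
import Literature.Probability.RandomPlanarGeometry.ChordalCurveFamily
import Literature.Probability.RandomPlanarGeometry.DiamondShearChart

/-!
# Crux `SegmentOpen` (stmt-CriticalPhenomena-5471), line `Sketch` — stub `stub_rectCapacity`

The model computation of the Dirichlet principle on `R = (0,w) × (0,h)`: the infimum of the
energies `∫_R ‖∇U‖²` over admissible `U` (C¹ on `R`, finite energy, `0` near the bottom side, `1`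
near the top side) is `w / h` (Ahlfors, *Conformal Invariants* (1973), §4-2). Lower bound: on
each vertical slice FTC and Cauchy–Schwarz (as `∫ (g' - c)² ≥ 0`) give `∫₀ʰ |∂_y U|² ≥ 1/h`, then
Tonelli over `x`. Upper bound: `U z = P (im z) / P h`, `P` the primitive of a continuous
trapezoid (`0` near `0` and `h`, `1` in the bulk), of energy `≤ w / (h - 4δ) → w / h`.
-/

noncomputable section

namespace Summit.CriticalPhenomena.CardyFormulaZ2.Theorems

open Literature.Probability Literature.Barriers.CriticalPhenomena
open Literature.Probability.RandomPlanarGeometry (ConformalRectangle ConformalEquiv MarkedDomain)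
open Filter Set Topology MeasureTheory
open UpperHalfPlane (upperHalfPlaneSet)
open scoped ENNReal
open Complex (I measurableEquivRealProd volume_preserving_equiv_real_prod)

namespace RectCapacity

/-- The rectangle read in `ℝ × ℝ`. -/
theorem preimage_rect (a b : ℝ) :
    measurableEquivRealProd.symm ⁻¹' (Ioo 0 a ×ℂ Ioo 0 b) = Ioo 0 a ×ˢ Ioo 0 b := by
  ext p
  simp [Complex.mem_reProdIm]

/-- Tonelli on `(0,a) × (0,b) ⊆ ℂ` with the vertical slices inside:
`∬ ρ = ∫₀ᵃ (∫₀ᵇ ρ (x + iy) dy) dx` for Borel `ρ`. -/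
theorem lintegral_rect_eq {ρ : ℂ → ℝ≥0∞} (hρ : Measurable ρ) (a b : ℝ) :
    ∫⁻ z in Ioo 0 a ×ℂ Ioo 0 b, ρ z = ∫⁻ x in Ioo 0 a, ∫⁻ y in Ioo 0 b, ρ ⟨x, y⟩ := by
  have hF : Measurable fun p : ℝ × ℝ => ρ (measurableEquivRealProd.symm p) :=
    hρ.comp measurableEquivRealProd.symm.measurable
  rw [← (volume_preserving_equiv_real_prod.symm
      measurableEquivRealProd).setLIntegral_comp_preimage_emb
    measurableEquivRealProd.symm.measurableEmbedding ρ, preimage_rect, Measure.volume_eq_prod,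
    ← Measure.prod_restrict, lintegral_prod _ hF.aemeasurable]
  rfl

/-- Fubini for a function of the height only: `∬_{(0,a)×(0,b)} G (im z) = a ∫₀ᵇ G`. -/
theorem setIntegral_rect_im (G : ℝ → ℝ) {a : ℝ} (ha : 0 ≤ a) (b : ℝ) :
    ∫ z in Ioo 0 a ×ℂ Ioo 0 b, G z.im = a * ∫ y in Ioo 0 b, G y := by
  rw [← (volume_preserving_equiv_real_prod.symm measurableEquivRealProd).setIntegral_preimage_emb
    measurableEquivRealProd.symm.measurableEmbedding (fun z => G z.im), preimage_rect,
    Measure.volume_eq_prod, ← Measure.prod_restrict]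
  simp only [Complex.measurableEquivRealProd_symm_apply]
  rw [integral_fun_snd, measureReal_restrict_apply_univ, Real.volume_real_Ioo, sub_zero,
    max_eq_left ha, smul_eq_mul]

/-- Tube lemma: an open set containing the horizontal side `[0,w] × {y₀}` contains a band
`[0,w] × (y₀ - ε, y₀ + ε)`. -/
theorem exists_band_subset {O : Set ℂ} (hO : IsOpen O) {w y₀ : ℝ}
    (hsub : ∀ z : ℂ, z.im = y₀ → z.re ∈ Icc 0 w → z ∈ O) :
    ∃ ε > 0, ∀ z : ℂ, z.re ∈ Icc 0 w → |z.im - y₀| < ε → z ∈ O := by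
  have hK : IsCompact (Icc 0 w ×ℂ {y₀}) := isCompact_Icc.reProdIm isCompact_singleton
  have hKO : Icc 0 w ×ℂ {y₀} ⊆ O := fun z hz =>
    hsub z (mem_singleton_iff.1 (Complex.mem_reProdIm.1 hz).2) (Complex.mem_reProdIm.1 hz).1
  obtain ⟨ε, hε, hεO⟩ := hK.exists_thickening_subset_open hO hKO
  refine ⟨ε, hε, fun z hre him => hεO (Metric.mem_thickening_iff.2 ⟨⟨z.re, y₀⟩, ?_, ?_⟩)⟩
  · exact Complex.mem_reProdIm.2 ⟨hre, rfl⟩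
  · rw [Complex.dist_of_re_eq (z := z) (w := ⟨z.re, y₀⟩) rfl, Real.dist_eq]
    exact him

/-- The one-dimensional estimate: if `g a = 0`, `g b = 1` and `g` is C¹ on `[a,b]`, then
`1/(b-a) ≤ ∫ₐᵇ g'²` (expand `0 ≤ ∫ₐᵇ (g' - 1/(b-a))²` and use `∫ₐᵇ g' = 1`). -/
theorem one_div_le_integral_sq {g g' : ℝ → ℝ} {a b : ℝ} (hab : a < b)
    (hderiv : ∀ y ∈ Icc a b, HasDerivAt g (g' y) y) (hcont : ContinuousOn g' (Icc a b))
    (hga : g a = 0) (hgb : g b = 1) : 1 / (b - a) ≤ ∫ y in a..b, g' y ^ 2 := by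
  have hI : uIcc a b = Icc a b := uIcc_of_le hab.le
  have hc1 : ContinuousOn g' (uIcc a b) := by rwa [hI]
  have hi1 : IntervalIntegrable g' volume a b := hc1.intervalIntegrable
  have hi2 : IntervalIntegrable (fun y => g' y ^ 2) volume a b := (hc1.pow 2).intervalIntegrable
  have hftc : ∫ y in a..b, g' y = 1 := by
    rw [intervalIntegral.integral_eq_sub_of_hasDerivAt (fun y hy => hderiv y (hI ▸ hy)) hi1, hga,
      hgb, sub_zero]
  set c := 1 / (b - a) with hc
  have hba : 0 < b - a := sub_pos.2 hab
  have hcc : c ^ 2 * (b - a) = c := by rw [hc]; field_simp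
  have hnonneg : 0 ≤ ∫ y in a..b, (g' y - c) ^ 2 :=
    intervalIntegral.integral_nonneg hab.le fun y _ => sq_nonneg _
  have hexp : ∫ y in a..b, (g' y - c) ^ 2 =
      (∫ y in a..b, g' y ^ 2) - 2 * c * (∫ y in a..b, g' y) + c ^ 2 * (b - a) := by
    have e : ∀ y, (g' y - c) ^ 2 = (g' y ^ 2 - (2 * c) * g' y) + c ^ 2 := fun y => by ring
    simp_rw [e]
    rw [intervalIntegral.integral_add (hi2.sub (hi1.const_mul _)) intervalIntegrable_const,
      intervalIntegral.integral_sub hi2 (hi1.const_mul _), intervalIntegral.integral_const_mul,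
      intervalIntegral.integral_const, smul_eq_mul]
    ring
  rw [hftc, hcc] at hexp
  linarith

/-- **Slice bound.** If `U` is C¹ on the open rectangle, vanishes on the part of the rectangle
at height `< ε₀` and equals `1` on the part at height `> h - ε₁`, then along every vertical slice
`∫₀ʰ ‖∇U (x + iy)‖² dy ≥ 1/h`. -/
theorem slice_bound {U : ℂ → ℝ} {w h x ε₀ ε₁ : ℝ} (hh : 0 < h)
    (hU : ContDiffOn ℝ 1 U (Ioo 0 w ×ℂ Ioo 0 h))
    (hε₀ : 0 < ε₀) (h0 : ∀ z ∈ Ioo 0 w ×ℂ Ioo 0 h, |z.im| < ε₀ → U z = 0)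
    (hε₁ : 0 < ε₁) (h1 : ∀ z ∈ Ioo 0 w ×ℂ Ioo 0 h, |z.im - h| < ε₁ → U z = 1)
    (hx : x ∈ Ioo 0 w) :
    ENNReal.ofReal (1 / h) ≤ ∫⁻ y in Ioo 0 h, ENNReal.ofReal (‖fderiv ℝ U ⟨x, y⟩‖ ^ 2) := by
  have hRo : IsOpen (Ioo 0 w ×ℂ Ioo 0 h) := isOpen_Ioo.reProdIm isOpen_Ioo
  obtain ⟨ε, hε, hεle₀, hεle₁, hεh⟩ : ∃ ε, 0 < ε ∧ ε ≤ ε₀ ∧ ε ≤ ε₁ ∧ ε ≤ h :=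
    ⟨min (min ε₀ ε₁) h, lt_min (lt_min hε₀ hε₁) hh, (min_le_left _ _).trans (min_le_left _ _),
      (min_le_left _ _).trans (min_le_right _ _), min_le_right _ _⟩
  set a := ε / 4 with ha
  set b := h - ε / 4 with hb
  have ha0 : 0 < a := by positivity
  have hab : a < b := by rw [ha, hb]; linarith
  have hbh : b < h := by rw [hb]; linarith
  have hIcc : Icc a b ⊆ Ioo 0 h := fun y hy => ⟨ha0.trans_le hy.1, hy.2.trans_lt hbh⟩
  -- the vertical slice through `x`
  have hmk : (fun y : ℝ => (⟨x, y⟩ : ℂ)) = fun y : ℝ => (x : ℂ) + ((y : ℝ) : ℂ) * I :=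
    funext fun y => Complex.mk_eq_add_mul_I x y
  have hγ : ∀ y : ℝ, HasDerivAt (fun y : ℝ => (⟨x, y⟩ : ℂ)) I y := fun y => by
    rw [hmk]
    simpa using ((hasDerivAt_id y).ofReal_comp.mul_const I).const_add (x : ℂ)
  have hγc : Continuous fun y : ℝ => (⟨x, y⟩ : ℂ) := by rw [hmk]; fun_prop
  have hγR : ∀ y ∈ Ioo 0 h, (⟨x, y⟩ : ℂ) ∈ Ioo 0 w ×ℂ Ioo 0 h := fun y hy =>
    Complex.mem_reProdIm.2 ⟨hx, hy⟩
  set g' : ℝ → ℝ := fun y => fderiv ℝ U ⟨x, y⟩ I with hg'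
  have hderiv : ∀ y ∈ Icc a b, HasDerivAt (fun y : ℝ => U ⟨x, y⟩) (g' y) y := fun y hy =>
    ((hU.differentiableOn one_ne_zero).differentiableAt
      (hRo.mem_nhds (hγR y (hIcc hy)))).hasFDerivAt.comp_hasDerivAt y (hγ y)
  have hcont : ContinuousOn g' (Icc a b) :=
    ((hU.continuousOn_fderiv_of_isOpen hRo le_rfl).comp hγc.continuousOn
      fun y hy => hγR y (hIcc hy)).clm_apply continuousOn_const
  have hga : U ⟨x, a⟩ = 0 :=
    h0 _ (hγR a ⟨ha0, hab.trans hbh⟩) (by show |a| < ε₀; rw [abs_of_pos ha0, ha]; linarith)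
  have hgb : U ⟨x, b⟩ = 1 := h1 _ (hγR b ⟨ha0.trans hab, hbh⟩) (by
    show |b - h| < ε₁
    rw [show b - h = -(ε / 4) by rw [hb]; ring, abs_neg, abs_of_pos (by positivity)]
    linarith)
  have hle : ∀ y, g' y ^ 2 ≤ ‖fderiv ℝ U ⟨x, y⟩‖ ^ 2 := fun y => by
    rw [← sq_abs]
    refine pow_le_pow_left₀ (abs_nonneg _) ?_ 2
    simpa [Real.norm_eq_abs] using (fderiv ℝ U ⟨x, y⟩).le_opNorm I
  have hint2 : IntegrableOn (fun y => g' y ^ 2) (Ioc a b) :=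
    ((hcont.pow 2).integrableOn_Icc).mono_set Ioc_subset_Icc_self
  calc ENNReal.ofReal (1 / h) ≤ ENNReal.ofReal (1 / (b - a)) :=
        ENNReal.ofReal_le_ofReal
          (one_div_le_one_div_of_le (sub_pos.2 hab) (by rw [hb, ha]; linarith))
    _ ≤ ENNReal.ofReal (∫ y in a..b, g' y ^ 2) :=
        ENNReal.ofReal_le_ofReal (one_div_le_integral_sq hab hderiv hcont hga hgb)
    _ = ∫⁻ y in Ioc a b, ENNReal.ofReal (g' y ^ 2) := by
        rw [intervalIntegral.integral_of_le hab.le,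
          ofReal_integral_eq_lintegral_ofReal hint2 (Eventually.of_forall fun y => sq_nonneg _)]
    _ ≤ ∫⁻ y in Ioc a b, ENNReal.ofReal (‖fderiv ℝ U ⟨x, y⟩‖ ^ 2) :=
        lintegral_mono fun y => ENNReal.ofReal_le_ofReal (hle y)
    _ ≤ ∫⁻ y in Ioo 0 h, ENNReal.ofReal (‖fderiv ℝ U ⟨x, y⟩‖ ^ 2) :=
        lintegral_mono_set fun y hy => ⟨ha0.trans hy.1, hy.2.trans_lt hbh⟩

/-- **Lower bound.** Every admissible test function on `(0,w) × (0,h)` has Dirichlet energy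
`≥ w / h`. -/
theorem lower_bound {U : ℂ → ℝ} {w h ε₀ ε₁ : ℝ} (hh : 0 < h)
    (hU : ContDiffOn ℝ 1 U (Ioo 0 w ×ℂ Ioo 0 h))
    (hint : IntegrableOn (fun z => ‖fderiv ℝ U z‖ ^ 2) (Ioo 0 w ×ℂ Ioo 0 h))
    (hε₀ : 0 < ε₀) (h0 : ∀ z ∈ Ioo 0 w ×ℂ Ioo 0 h, |z.im| < ε₀ → U z = 0)
    (hε₁ : 0 < ε₁) (h1 : ∀ z ∈ Ioo 0 w ×ℂ Ioo 0 h, |z.im - h| < ε₁ → U z = 1) :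
    w / h ≤ ∫ z in Ioo 0 w ×ℂ Ioo 0 h, ‖fderiv ℝ U z‖ ^ 2 := by
  have hmeas : Measurable fun z => ‖fderiv ℝ U z‖ ^ 2 :=
    (measurable_fderiv ℝ U).norm.pow_const 2
  have hnn : 0 ≤ᵐ[volume.restrict (Ioo 0 w ×ℂ Ioo 0 h)] fun z => ‖fderiv ℝ U z‖ ^ 2 :=
    Eventually.of_forall fun z => sq_nonneg _
  rw [integral_eq_lintegral_of_nonneg_ae hnn hmeas.aestronglyMeasurable]
  have hfin : ∫⁻ z in Ioo 0 w ×ℂ Ioo 0 h, ENNReal.ofReal (‖fderiv ℝ U z‖ ^ 2) ≠ ∞ :=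
    ((hasFiniteIntegral_iff_ofReal hnn).1 hint.hasFiniteIntegral).ne
  refine (ENNReal.ofReal_le_iff_le_toReal hfin).1 ?_
  rw [lintegral_rect_eq hmeas.ennreal_ofReal]
  calc ENNReal.ofReal (w / h) = ENNReal.ofReal (1 / h) * volume (Ioo (0 : ℝ) w) := by
        rw [Real.volume_Ioo, sub_zero, ← ENNReal.ofReal_mul (by positivity), one_div_mul_eq_div]
    _ = ∫⁻ _ in Ioo (0 : ℝ) w, ENNReal.ofReal (1 / h) := (setLIntegral_const _ _).symm
    _ ≤ ∫⁻ x in Ioo 0 w, ∫⁻ y in Ioo 0 h, ENNReal.ofReal (‖fderiv ℝ U ⟨x, y⟩‖ ^ 2) :=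
        setLIntegral_mono' measurableSet_Ioo fun x hx => slice_bound hh hU hε₀ h0 hε₁ h1 hx

/-- The trapezoid `k_δ(t) = max 0 (min 1 (min (t/δ - 1) ((h - t)/δ - 1)))` vanishes below `δ`
and above `h - δ`. -/
theorem trap_eq_zero {δ h t : ℝ} (hδ : 0 < δ) (ht : t ≤ δ ∨ h - δ ≤ t) :
    max 0 (min 1 (min (t / δ - 1) ((h - t) / δ - 1))) = 0 := by
  refine max_eq_left ((min_le_right _ _).trans ?_)
  rcases ht with ht | ht
  · exact (min_le_left _ _).trans (by rw [sub_nonpos, div_le_one hδ]; exact ht)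
  · exact (min_le_right _ _).trans (by rw [sub_nonpos, div_le_one hδ]; linarith)

/-- The trapezoid `k_δ` equals `1` on `[2δ, h - 2δ]`. -/
theorem trap_eq_one {δ h t : ℝ} (hδ : 0 < δ) (ht : t ∈ Icc (2 * δ) (h - 2 * δ)) :
    max 0 (min 1 (min (t / δ - 1) ((h - t) / δ - 1))) = 1 := by
  have h1 : 1 ≤ t / δ - 1 := by rw [le_sub_iff_add_le, le_div_iff₀ hδ]; linarith [ht.1]
  have h2 : 1 ≤ (h - t) / δ - 1 := by rw [le_sub_iff_add_le, le_div_iff₀ hδ]; linarith [ht.2]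
  rw [min_eq_left (le_min h1 h2), max_eq_right zero_le_one]

/-- **The energy of a height profile.** For continuous `k` and `U z = (∫₀^{im z} k) / K`: `U` is
C¹ with `‖dU(z)‖² = (k (im z) / K)²`, and its energy on `(0,w) × (0,h)` is `w ∫₀ʰ k² / K²`. -/
theorem profile_energy {k : ℝ → ℝ} (hkc : Continuous k) (K : ℝ) {w h : ℝ} (hw : 0 ≤ w)
    (hh : 0 ≤ h) :
    ContDiff ℝ 1 (fun z : ℂ => (∫ t in (0 : ℝ)..z.im, k t) / K) ∧
    IntegrableOn (fun z => ‖fderiv ℝ (fun z : ℂ => (∫ t in (0 : ℝ)..z.im, k t) / K) z‖ ^ 2)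
      (Ioo 0 w ×ℂ Ioo 0 h) ∧
    ∫ z in Ioo 0 w ×ℂ Ioo 0 h, ‖fderiv ℝ (fun z : ℂ => (∫ t in (0 : ℝ)..z.im, k t) / K) z‖ ^ 2 =
      w * ((∫ t in (0 : ℝ)..h, k t ^ 2) / K ^ 2) := by
  have hPd : ∀ y, HasDerivAt (fun y => (∫ t in (0 : ℝ)..y, k t) / K) (k y / K) y := fun y =>
    (hkc.integral_hasStrictDerivAt 0 y).hasDerivAt.div_const K
  have hU : ∀ z : ℂ, HasFDerivAt (fun z : ℂ => (∫ t in (0 : ℝ)..z.im, k t) / K)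
      ((k z.im / K) • Complex.imCLM) z := fun z =>
    (hPd z.im).comp_hasFDerivAt z Complex.imCLM.hasFDerivAt
  have hnorm : ∀ z : ℂ, ‖fderiv ℝ (fun z : ℂ => (∫ t in (0 : ℝ)..z.im, k t) / K) z‖ ^ 2 =
      (k z.im / K) ^ 2 := fun z => by
    rw [(hU z).fderiv, norm_smul, Complex.imCLM_norm, mul_one, Real.norm_eq_abs, sq_abs]
  refine ⟨?_, ?_, ?_⟩
  · have hg : ContDiff ℝ 1 (fun y => (∫ t in (0 : ℝ)..y, k t) / K) := by
      rw [contDiff_one_iff_deriv]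
      refine ⟨fun y => (hPd y).differentiableAt, ?_⟩
      rw [show deriv (fun y => (∫ t in (0 : ℝ)..y, k t) / K) = fun y => k y / K from
        funext fun y => (hPd y).deriv]
      exact hkc.div_const _
    exact hg.comp Complex.imCLM.contDiff
  · simp only [hnorm]
    have hc : Continuous fun z : ℂ => (k z.im / K) ^ 2 :=
      ((hkc.comp Complex.continuous_im).div_const _).pow 2
    exact (hc.continuousOn.integrableOn_compact (isCompact_Icc.reProdIm isCompact_Icc)).mono_set
      fun z hz => ⟨Ioo_subset_Icc_self hz.1, Ioo_subset_Icc_self hz.2⟩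
  · simp only [hnorm]
    rw [setIntegral_rect_im (fun y => (k y / K) ^ 2) hw h, ← integral_Ioc_eq_integral_Ioo,
      ← intervalIntegral.integral_of_le hh]
    simp_rw [div_pow]
    rw [intervalIntegral.integral_div]

/-- **Upper bound.** For `0 < 4δ < h`: a C¹ function on `ℂ`, `0` at height `≤ δ`, `1` at height
`≥ h - δ`, of energy `≤ w / (h - 4δ)` on `(0,w) × (0,h)` — the normalised primitive
`U z = (∫₀^{im z} k_δ) / ∫₀ʰ k_δ` of the trapezoid (`∫ k_δ² ≤ ∫ k_δ`, `∫₀ʰ k_δ ≥ h - 4δ`). -/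
theorem exists_testFn {δ w h : ℝ} (hδ : 0 < δ) (h4 : 4 * δ < h) (hw : 0 < w) :
    ∃ U : ℂ → ℝ, ContDiff ℝ 1 U ∧
      IntegrableOn (fun z => ‖fderiv ℝ U z‖ ^ 2) (Ioo 0 w ×ℂ Ioo 0 h) ∧
      (∀ z : ℂ, z.im ≤ δ → U z = 0) ∧ (∀ z : ℂ, h - δ ≤ z.im → U z = 1) ∧
      ∫ z in Ioo 0 w ×ℂ Ioo 0 h, ‖fderiv ℝ U z‖ ^ 2 ≤ w / (h - 4 * δ) := by
  obtain ⟨k, hk0, hk1, hkc, hkz, hko⟩ : ∃ k : ℝ → ℝ, (∀ t, 0 ≤ k t) ∧ (∀ t, k t ≤ 1) ∧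
      Continuous k ∧ (∀ t, t ≤ δ ∨ h - δ ≤ t → k t = 0) ∧
      ∀ t ∈ Icc (2 * δ) (h - 2 * δ), k t = 1 :=
    ⟨fun t => max 0 (min 1 (min (t / δ - 1) ((h - t) / δ - 1))), fun t => le_max_left _ _,
      fun t => max_le zero_le_one (min_le_left _ _), by fun_prop, fun t ht => trap_eq_zero hδ ht,
      fun t ht => trap_eq_one hδ ht⟩
  have hi : ∀ a b : ℝ, IntervalIntegrable k volume a b := fun a b => hkc.intervalIntegrable a b
  set K := ∫ t in (0 : ℝ)..h, k t with hK
  have hKle : h - 4 * δ ≤ K := by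
    rw [hK, ← intervalIntegral.integral_add_adjacent_intervals (hi 0 (2 * δ)) (hi (2 * δ) h),
      ← intervalIntegral.integral_add_adjacent_intervals (hi (2 * δ) (h - 2 * δ))
        (hi (h - 2 * δ) h)]
    have h1 : 0 ≤ ∫ t in (0 : ℝ)..(2 * δ), k t :=
      intervalIntegral.integral_nonneg (by linarith) fun t _ => hk0 t
    have h3 : 0 ≤ ∫ t in (h - 2 * δ)..h, k t :=
      intervalIntegral.integral_nonneg (by linarith) fun t _ => hk0 t
    have h2 : ∫ t in (2 * δ)..(h - 2 * δ), k t = h - 4 * δ := by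
      rw [intervalIntegral.integral_congr (g := fun _ => (1 : ℝ)) fun t ht => ?_,
        intervalIntegral.integral_const, smul_eq_mul, mul_one]
      · ring
      · rw [uIcc_of_le (by linarith)] at ht
        exact hko t ht
    linarith
  have hK0 : 0 < K := by linarith
  obtain ⟨hcd, hint, hen⟩ := profile_energy hkc K hw.le (by linarith : (0 : ℝ) ≤ h)
  refine ⟨fun z => (∫ t in (0 : ℝ)..z.im, k t) / K, hcd, hint, fun z hz => ?_, fun z hz => ?_, ?_⟩
  · show (∫ t in (0 : ℝ)..z.im, k t) / K = 0
    rw [intervalIntegral.integral_congr (g := fun _ => (0 : ℝ)) fun t ht => ?_,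
      intervalIntegral.integral_zero, zero_div]
    exact hkz t (Or.inl (ht.2.trans (max_le hδ.le hz)))
  · show (∫ t in (0 : ℝ)..z.im, k t) / K = 1
    rw [div_eq_one_iff_eq hK0.ne', hK,
      ← intervalIntegral.integral_add_adjacent_intervals (hi 0 h) (hi h z.im),
      intervalIntegral.integral_congr (g := fun _ => (0 : ℝ)) (a := h) fun t ht => ?_,
      intervalIntegral.integral_zero, add_zero]
    exact hkz t (Or.inr (le_trans (le_min (by linarith) hz) ht.1))
  · rw [hen]
    have h2 : ∫ t in (0 : ℝ)..h, k t ^ 2 ≤ K :=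
      intervalIntegral.integral_mono_on (by linarith) ((hkc.pow 2).intervalIntegrable 0 h)
        (hi 0 h) fun t _ => pow_le_of_le_one (hk0 t) (hk1 t) two_ne_zero
    calc w * ((∫ t in (0 : ℝ)..h, k t ^ 2) / K ^ 2) ≤ w * (K / K ^ 2) :=
          mul_le_mul_of_nonneg_left (div_le_div_of_nonneg_right h2 (sq_nonneg _)) hw.le
      _ = w / K := by field_simp
      _ ≤ w / (h - 4 * δ) := div_le_div_of_nonneg_left hw.le (by linarith) hKle

/-- Choice of the parameter: `w / (h - 4δ) → w / h` as `δ → 0⁺`. -/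
theorem exists_delta {w h ε : ℝ} (hh : 0 < h) (hε : 0 < ε) :
    ∃ δ : ℝ, 0 < δ ∧ 4 * δ < h ∧ w / (h - 4 * δ) < w / h + ε := by
  have hca : ContinuousAt (fun δ : ℝ => w / (h - 4 * δ)) 0 := by
    fun_prop (disch := simpa using hh.ne')
  have hlim : Tendsto (fun δ : ℝ => w / (h - 4 * δ)) (𝓝 0) (𝓝 (w / h)) := by
    simpa using hca.tendsto
  have e1 : ∀ᶠ δ in 𝓝[>] (0 : ℝ), 0 < δ := eventually_mem_nhdsWithin
  have e2 : ∀ᶠ δ in 𝓝 (0 : ℝ), δ < h / 4 := Iio_mem_nhds (by positivity)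
  have e3 : ∀ᶠ δ in 𝓝 (0 : ℝ), w / (h - 4 * δ) < w / h + ε :=
    hlim.eventually_lt_const (by linarith)
  obtain ⟨δ, hδ, h4, hlt⟩ := (e1.and ((e2.and e3).filter_mono nhdsWithin_le_nhds)).exists
  exact ⟨δ, hδ, by linarith, hlt⟩

/-- Infimum characterisation used to assemble the two bounds. -/
theorem sInf_eq_of_forall {S : Set ℝ} {m : ℝ} (hlow : ∀ e ∈ S, m ≤ e)
    (hup : ∀ ε > 0, ∃ e ∈ S, e < m + ε) : sInf S = m := by
  have hne : S.Nonempty := let ⟨e, he, _⟩ := hup 1 one_pos; ⟨e, he⟩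
  refine le_antisymm (le_of_forall_pos_lt_add fun ε hε => ?_) (le_csInf hne hlow)
  obtain ⟨e, he, hlt⟩ := hup ε hε
  exact (csInf_le ⟨m, hlow⟩ he).trans_lt hlt

end RectCapacity

open RectCapacity in
/-- **The minimal admissible Dirichlet energy of the rectangle `(0,w) × (0,h)` is `w / h`**
(Ahlfors, *Conformal Invariants* (1973), §4-2: extremal length / capacity of a rectangle), the
admissible test functions being C¹ on the open rectangle with finite energy, `0` near the bottom
side (arc `0`) and `1` near the top side (arc `2`). Lower bound: slice-wise Cauchy–Schwarz and
Tonelli; upper bound: normalised primitives of trapezoids. -/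
theorem stub_rectCapacity :
    ∀ (w h : ℝ) (hw : 0 < w) (hh : 0 < h),
      sInf {e : ℝ | ∃ U : ℂ → ℝ,
          (ContDiffOn ℝ 1 U (Percolation.rectQuad 0 w 0 h hw hh).carrier ∧
            IntegrableOn (fun z => ‖fderiv ℝ U z‖ ^ 2) (Percolation.rectQuad 0 w 0 h hw hh).carrier ∧
            (∃ O : Set ℂ, IsOpen O ∧ (Percolation.rectQuad 0 w 0 h hw hh).arc 0 ⊆ O ∧
              ∀ z ∈ O ∩ (Percolation.rectQuad 0 w 0 h hw hh).carrier, U z = 0) ∧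
            (∃ O : Set ℂ, IsOpen O ∧ (Percolation.rectQuad 0 w 0 h hw hh).arc 2 ⊆ O ∧
              ∀ z ∈ O ∩ (Percolation.rectQuad 0 w 0 h hw hh).carrier, U z = 1)) ∧
          e = ∫ z in (Percolation.rectQuad 0 w 0 h hw hh).carrier, ‖fderiv ℝ U z‖ ^ 2} =
        w / h := by
  intro w h hw hh
  have hcar : (Percolation.rectQuad 0 w 0 h hw hh).carrier = Ioo 0 w ×ℂ Ioo 0 h :=
    Percolation.rectQuad_carrier hw hh
  refine sInf_eq_of_forall ?_ fun ε hε => ?_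
  · -- lower bound
    rintro e ⟨U, ⟨hU, hint, ⟨O, hO, hO0, hU0⟩, ⟨O', hO', hO2, hU1⟩⟩, rfl⟩
    rw [hcar] at hU hint hU0 hU1 ⊢
    obtain ⟨ε₀, hε₀, h0⟩ := exists_band_subset hO (y₀ := 0) (w := w)
      fun z hz1 hz2 => hO0 ((Percolation.mem_rectQuad_arc_zero hw hh).2 ⟨hz1, hz2⟩)
    obtain ⟨ε₁, hε₁, h1⟩ := exists_band_subset hO' (y₀ := h) (w := w)
      fun z hz1 hz2 => hO2 ((Percolation.mem_rectQuad_arc_two hw hh).2 ⟨hz1, hz2⟩)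
    refine lower_bound hh hU hint hε₀ (fun z hz him => hU0 z ⟨h0 z ?_ (by simpa using him), hz⟩)
      hε₁ (fun z hz him => hU1 z ⟨h1 z ?_ him, hz⟩)
    · exact Ioo_subset_Icc_self (Complex.mem_reProdIm.1 hz).1
    · exact Ioo_subset_Icc_self (Complex.mem_reProdIm.1 hz).1
  · -- upper bound
    obtain ⟨δ, hδ, h4, hlt⟩ := exists_delta (w := w) hh hε
    obtain ⟨U, hU, hint, hU0, hU1, hen⟩ := exists_testFn hδ h4 hw
    refine ⟨_, ⟨U, ⟨hU.contDiffOn, by rw [hcar]; exact hint, ?_, ?_⟩, rfl⟩, ?_⟩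
    · refine ⟨{z : ℂ | z.im < δ}, isOpen_lt Complex.continuous_im continuous_const,
        fun z hz => ?_, fun z hz => hU0 z (le_of_lt hz.1)⟩
      show z.im < δ
      rw [((Percolation.mem_rectQuad_arc_zero hw hh).1 hz).1]
      exact hδ
    · refine ⟨{z : ℂ | h - δ < z.im}, isOpen_lt continuous_const Complex.continuous_im,
        fun z hz => ?_, fun z hz => hU1 z (le_of_lt hz.1)⟩
      show h - δ < z.im
      rw [((Percolation.mem_rectQuad_arc_two hw hh).1 hz).1]
      linarith
    · rw [hcar]
      exact hen.trans_lt hlt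

end Summit.CriticalPhenomena.CardyFormulaZ2.Theorems
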